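import Mathlib
import Literature.MathematicalPhysics.StatisticalMechanics.Crystallization
import Literature.MathematicalPhysics.StatisticalMechanics.LennardJonesClusters
import Summits.AtomisticToContinuum.Crystallization.Theorems.NearFarGlueR.Negative.PointwiseContactGap

/-!
# `ExactCertificate` (stmt-AtomisticToContinuum-11959), line `closure-makes-nogap-exact`,
# Transfer skeleton II (`Cruxes.ExactCertificate.Transfer1D.Crystallization1D`): stub `stub_lineMaxGap`

Support file for the crux `ThreeConeCertificate.ExactCertificate` (crux 11959), line
`closure-makes-nogap-exact`, TRANSFER skeleton II `Crystallization1D` (positional crystallization of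
the Lennard-Jones CHAIN, `d = 1`).  With `V = lennardJones`, `y : ℕ → ℝ` the sorted positions of `N`
particles on a line and the LINE ENERGY `∑ i < N, ∑ i < j < N, V (|y j - y i|)`, this file proves the
registered stub `stub_lineMaxGap`: if `y` is strictly increasing on `range N` and minimises the line
energy among all configurations of `N` pairwise distinct reals, then EVERY NEAREST-NEIGHBOUR GAP IS
`≤ 1` (the upper edge of the minimality box; no dependence on the lattice constant).

Mechanism (contraction competitor).  Suppose `d := y (i+1) - y i > 1` and put `L := d - 1 > 0`.
The competitor `y' k := if k ≤ i then y k else y k - L` is still strictly increasing (a straddling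
pair `p ≤ i < q` has `y' q - y' p = 1 + (y q - y (i+1)) + (y i - y p) ≥ 1`).  Pair by pair: both
indices `≤ i` or both `> i` — unchanged; the pair `(i, i+1)` goes from `d` to exactly `1`, a STRICT
gain since `V` has its strict global minimum at `1` (`V(r) - V(1) = (u - 1)²/12`, `u = r⁻⁶ ≠ 1`);
every other straddling pair goes from `s` to `s - L ∈ [1, s]`, where `V` is increasing on `[1, ∞)`
(the landed `NearFarGlueRNegative.lennardJones_mono_of_one_le`, imported).  Summing termwise
(`Finset.sum_lt_sum`, strict in the inner sum at `i`) the competitor has strictly smaller line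
energy, contradicting minimality.  Helper lemmas are prefixed `maxGap_`; all `[folklore]`.
-/

noncomputable section

namespace Summit.AtomisticToContinuum.Crystallization.Theorems.ThreeConeCertificateExactCertificate.Transfer1D

open Literature.MathematicalPhysics.StatisticalMechanics
open Summit.AtomisticToContinuum.Crystallization.Theorems.NearFarGlueRNegative
  (lennardJones_mono_of_one_le)
open scoped BigOperators

/-! ## The strict minimum of `V_LJ` at `1` (monotonicity on `[1, ∞)` is the imported
`NearFarGlueRNegative.lennardJones_mono_of_one_le`) -/

/-- `V_LJ` has a STRICT global minimum at `1`: for `1 < d`, `V_LJ(1) < V_LJ(d)`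
(`V_LJ(d) - V_LJ(1) = (u - 1)²/12 > 0` with `u = d⁻⁶ < 1`). [folklore] -/
theorem maxGap_lennardJones_one_lt {d : ℝ} (hd : 1 < d) : lennardJones 1 < lennardJones d := by
  rw [lennardJones_one]
  unfold lennardJones
  have hd0 : 0 < d := by linarith
  set u : ℝ := (d⁻¹) ^ 6 with hu
  have hu1 : u < 1 := by
    rw [hu]; exact pow_lt_one₀ (inv_nonneg.2 hd0.le) (inv_lt_one_of_one_lt₀ hd) (by norm_num)
  have h12 : (d⁻¹) ^ 12 = u ^ 2 := by rw [hu, ← pow_mul]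
  rw [h12]
  nlinarith [mul_pos (sub_pos.2 hu1) (sub_pos.2 hu1)]

/-! ## The contraction competitor, pair by pair -/

/-- A configuration strictly increasing on `range N` is weakly increasing there. [folklore] -/
theorem maxGap_le_of_le {N : ℕ} {y : ℕ → ℝ} (hy : ∀ i j : ℕ, i < j → j < N → y i < y j)
    {p q : ℕ} (hpq : p ≤ q) (hq : q < N) : y p ≤ y q := by
  rcases hpq.lt_or_eq with h | rfl
  · exact (hy p q h hq).le
  · exact le_rfl

/-- The contraction competitor `y'` (`= y` up to index `i`, `= y - L` beyond, `L = y (i+1) - y i - 1`)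
of a strictly increasing configuration is strictly increasing on `range N`: a straddling pair
`p ≤ i < q` has `y' q - y' p = 1 + (y q - y (i+1)) + (y i - y p) ≥ 1`. [folklore] -/
theorem maxGap_strictMono {N i : ℕ} {y y' : ℕ → ℝ} {L : ℝ}
    (hy : ∀ i j : ℕ, i < j → j < N → y i < y j) (hi : i + 1 < N)
    (hL : L = y (i + 1) - y i - 1)
    (h1 : ∀ k, k ≤ i → y' k = y k) (h2 : ∀ k, i < k → y' k = y k - L)
    {p q : ℕ} (hpq : p < q) (hq : q < N) : y' p < y' q := by
  by_cases hqi : q ≤ i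
  · rw [h1 q hqi, h1 p (hpq.le.trans hqi)]
    exact hy p q hpq hq
  · rw [not_le] at hqi
    by_cases hpi : p ≤ i
    · rw [h2 q hqi, h1 p hpi]
      have hq1 : y (i + 1) ≤ y q := maxGap_le_of_le hy (Nat.succ_le_of_lt hqi) hq
      have hp1 : y p ≤ y i := maxGap_le_of_le hy hpi (by omega)
      rw [hL]
      linarith
    · rw [not_le] at hpi
      rw [h2 q hqi, h2 p hpi]
      linarith [hy p q hpq hq]

/-- Termwise comparison: for every pair `p < q < N` the competitor's pair energy is at most the
original one.  Both indices `≤ i` or both `> i`: the distance is unchanged; `p ≤ i < q`: the distance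
drops from `s = y q - y p` to `s - L = 1 + (y q - y (i+1)) + (y i - y p) ∈ [1, s]`, where `V_LJ` is
increasing. [folklore] -/
theorem maxGap_termwise {N i : ℕ} {y y' : ℕ → ℝ} {L : ℝ}
    (hy : ∀ i j : ℕ, i < j → j < N → y i < y j) (hi : i + 1 < N)
    (hL : L = y (i + 1) - y i - 1) (hL0 : 0 < L)
    (h1 : ∀ k, k ≤ i → y' k = y k) (h2 : ∀ k, i < k → y' k = y k - L)
    {p q : ℕ} (hpq : p < q) (hq : q < N) :
    lennardJones (|y' q - y' p|) ≤ lennardJones (|y q - y p|) := by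
  by_cases hqi : q ≤ i
  · rw [h1 q hqi, h1 p (hpq.le.trans hqi)]
  · rw [not_le] at hqi
    by_cases hpi : p ≤ i
    · rw [h2 q hqi, h1 p hpi]
      have hq1 : y (i + 1) ≤ y q := maxGap_le_of_le hy (Nat.succ_le_of_lt hqi) hq
      have hp1 : y p ≤ y i := maxGap_le_of_le hy hpi (by omega)
      have hlow : 1 ≤ y q - L - y p := by rw [hL]; linarith
      have hle : y q - L - y p ≤ y q - y p := by linarith
      rw [abs_of_pos (by linarith : 0 < y q - L - y p), abs_of_pos (by linarith : 0 < y q - y p)]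
      exact lennardJones_mono_of_one_le hlow hle
    · rw [not_le] at hpi
      rw [h2 q hqi, h2 p hpi, show y q - L - (y p - L) = y q - y p by ring]

/-- The contracted pair itself gains strictly: its distance drops from `y (i+1) - y i = 1 + L > 1` to
exactly `1`, the strict minimum of `V_LJ`. [folklore] -/
theorem maxGap_strict {i : ℕ} {y y' : ℕ → ℝ} {L : ℝ}
    (hL : L = y (i + 1) - y i - 1) (hL0 : 0 < L)
    (h1 : ∀ k, k ≤ i → y' k = y k) (h2 : ∀ k, i < k → y' k = y k - L) :
    lennardJones (|y' (i + 1) - y' i|) < lennardJones (|y (i + 1) - y i|) := by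
  rw [h2 (i + 1) (Nat.lt_succ_self i), h1 i le_rfl]
  have hd : 1 < y (i + 1) - y i := by linarith
  rw [show y (i + 1) - L - y i = 1 by rw [hL]; ring, abs_one,
    abs_of_pos (by linarith : 0 < y (i + 1) - y i)]
  exact maxGap_lennardJones_one_lt hd

/-- Summing termwise: the competitor has STRICTLY smaller line energy (`Finset.sum_le_sum` in every
inner sum, `Finset.sum_lt_sum` at the outer index `i` and the inner index `i + 1`). [folklore] -/
theorem maxGap_energy_lt {N i : ℕ} {y y' : ℕ → ℝ} {L : ℝ}
    (hy : ∀ i j : ℕ, i < j → j < N → y i < y j) (hi : i + 1 < N)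
    (hL : L = y (i + 1) - y i - 1) (hL0 : 0 < L)
    (h1 : ∀ k, k ≤ i → y' k = y k) (h2 : ∀ k, i < k → y' k = y k - L) :
    ∑ p ∈ Finset.range N, ∑ q ∈ Finset.Ico (p + 1) N, lennardJones (|y' q - y' p|) <
      ∑ p ∈ Finset.range N, ∑ q ∈ Finset.Ico (p + 1) N, lennardJones (|y q - y p|) := by
  refine Finset.sum_lt_sum (fun p _ => Finset.sum_le_sum fun q hq => ?_) ⟨i, ?_, ?_⟩
  · obtain ⟨hpq, hqN⟩ := Finset.mem_Ico.1 hq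
    exact maxGap_termwise hy hi hL hL0 h1 h2 (Nat.lt_of_succ_le hpq) hqN
  · exact Finset.mem_range.2 (by omega)
  · refine Finset.sum_lt_sum (fun q hq => ?_)
      ⟨i + 1, Finset.mem_Ico.2 ⟨le_rfl, hi⟩, maxGap_strict hL hL0 h1 h2⟩
    obtain ⟨hpq, hqN⟩ := Finset.mem_Ico.1 hq
    exact maxGap_termwise hy hi hL hL0 h1 h2 (Nat.lt_of_succ_le hpq) hqN

/-! ## The registered stub -/

/-- STUB (C) `stub_lineMaxGap` — MAXIMAL GAP `1`.  If `y` is strictly increasing on `range N` and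
minimises the line energy `∑ i < N, ∑ i < j < N, V_LJ (|y j - y i|)` among all configurations of `N`
pairwise distinct reals, then every nearest-neighbour gap is `≤ 1`: a gap `d > 1` is better
contracted to exactly `1` (the pair itself gains `V(1) - V(d) < 0`, every other straddling pair moves
from `s` to `s - (d - 1) ≥ 1`, where `V` increases).  No dependence on the lattice constant.
[folklore] -/
theorem stub_lineMaxGap : ∀ (N : ℕ) (y : ℕ → ℝ),
    (∀ i j : ℕ, i < j → j < N → y i < y j) →
    (∀ y' : ℕ → ℝ, (∀ i j : ℕ, i < j → j < N → y' i ≠ y' j) →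
      ∑ i ∈ Finset.range N, ∑ j ∈ Finset.Ico (i + 1) N, lennardJones (|y j - y i|) ≤
        ∑ i ∈ Finset.range N, ∑ j ∈ Finset.Ico (i + 1) N, lennardJones (|y' j - y' i|)) →
    ∀ i : ℕ, i + 1 < N → y (i + 1) - y i ≤ 1 := by
  intro N y hy hmin i hi
  by_contra hgt
  rw [not_le] at hgt
  set L : ℝ := y (i + 1) - y i - 1 with hL
  have hL0 : 0 < L := by rw [hL]; linarith
  set y' : ℕ → ℝ := fun k => if k ≤ i then y k else y k - L with hy'
  have h1 : ∀ k, k ≤ i → y' k = y k := fun k hk => by rw [hy']; exact if_pos hk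
  have h2 : ∀ k, i < k → y' k = y k - L := fun k hk => by rw [hy']; exact if_neg (not_le.2 hk)
  have hinj : ∀ p q : ℕ, p < q → q < N → y' p ≠ y' q :=
    fun p q hpq hq => (maxGap_strictMono hy hi hL h1 h2 hpq hq).ne
  exact absurd (hmin y' hinj) (not_le.2 (maxGap_energy_lt hy hi hL hL0 h1 h2))

end Summit.AtomisticToContinuum.Crystallization.Theorems.ThreeConeCertificateExactCertificate.Transfer1D

end
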